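import Summits.BirchSwinnertonDyer.BirchSwinnertonDyer.Theorems.ShaPrimaryTransferFiniteShaComponentTransferZywinaEqualityDoorKato
import Summits.BirchSwinnertonDyer.BirchSwinnertonDyer.Theorems.Rank2ObservatoryPadicSymbolTableL
import Summits.BirchSwinnertonDyer.Rank2.ZywinaMembersBSDRank
import Summits.BirchSwinnertonDyer.BirchSwinnertonDyer.Theorems.ShaPrimaryTransferFiniteShaComponentTransferRowAtFive
import HarnessLib

/-!
# BirchSwinnertonDyer / ShaPrimaryTransfer — crux `FiniteShaComponentTransfer` (stmt-BirchSwinnertonDyer-22356):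
# the `5`-adic equality door CLOSED on two members of Zywina's rank-2 family by level-`25` Riemann-sum
# certificates — `E_{11,24}` (conductor `2³·3·11·9227²·14411 ≈ 3.2·10¹⁴`) and `E_{659,12}` (`≈ 5.9·10¹⁴`, §5), main-conjecture-free

Helper file (`--supports stmt-BirchSwinnertonDyer-22356`); it closes nothing and BSD is not proved by it.
HONEST FRAMING: a per-curve certified theorem modulo named print and explicit symbol DATA; no claim on BSD
in rank `≥ 2`; no `S0` motion (Barrier B1 untouched: nothing here bounds an analytic rank).

The companion files typed the `5`-adic EQUALITY DOOR on Zywina's family `E_{m,n}` (`…ZywinaEqualityDoor`,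
`…Kato`, `…Descent`): `ord_{T=0} L_5(E_{m,n},T) = 2 (= rank)` ⟺ `Ш(E_{m,n})[5^∞]` finite, the direction
analytic ⟹ algebraic costing only Perrin-Riou–Schneider (`h85`) and Kato's divisibility (`hkato`).  What turns
Kato's INEQUALITY `rank ≤ ord_{T=0} L_5` into EQUALITY on a member is therefore ONE `5`-adic analytic fact,
`ord_{T=0} L_5 ≤ 2`, and by Mazur–Tate–Teitelbaum §I.13 that fact has a FINITE certificate: the level-`25`
Riemann sum of the `5`-adic measure against `binom(log_γ⟨u⟩, 2)` is a `5`-adic unit, i.e. `5 ∤ A·ΣHi − ΣLo` for the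
`20 + 4` plus modular symbols `[u/25]⁺`, `[v/5]⁺` of the newform (tree: `SymbolCertL.validL`,
`padicRow_of_symbolCertL`, the format of the rank-2 `p`-adic atlas `Rank2ObservatoryPadicAtlas*`).

For conductors `≈ 10¹⁴` no modular-symbol SPACE can be computed, but the 24 symbols can: for `gcd(m', N) = 1`
Birch's formula `Σ_a χ(a)·{∞, a/m'} = τ(χ)·L(f, χ̄, 1)` (tree fact `twisted_LValue_eq`) inverts over the even
Dirichlet characters mod `25` and mod `5`, each `L(f ⊗ χ, 1)` being a rapidly convergent series of `≈ 3·10⁹` terms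
at this conductor; and the symbols are EXACT half-integers in the newform's period unit — `gcd(25, N) = 1` makes
every cusp `a/25` `Γ₀(N)`-equivalent to `0`, and `{∞,0} = L(f,1)·(…) = 0` (rank `2`, Gross–Zagier–Kolyvagin) — so
rigorous error bounds (`< 4·10⁻⁸` on numbers that come out as even integers to within `2·10⁻¹⁶`) identify them, up to ONE common scale factor which is a `5`-adic unit (the Manin
constant is supported at the additive primes `2, 9227`, Mazur 1978 / Česnavičius 2018; the `2`-isogeny changes
periods by powers of `2`).  Cell bsd-rank2, seat p2, GEN 58, kit job `j339121` (395 s on 48 cores; engine `cert5_main.py`, memo `pub/bsd-rank2/p2/g58/CERT5-SPEC.md`; calibrated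
against PARI's exact modular symbols on `11a1, 389a1, 433a1, 5077a1`, job `j339107`: all 78 symbols agree to
`10⁻¹³`, and the `389a1` cell reproduces the atlas cell `c389a1` at `p = 5`).

What IS decided in the kernel (no hypothesis): `(11, 24)` is Zywina-admissible (`11, 9227, 14411` are primes
`≡ 11 (mod 24)`); `a₅(E_{11,24}) = −4` (point count of `y² = x³ + 3x` over `𝔽₅`); the certificate `cell.validL 5 (−4)`
of the tabulated symbol numerators (`decide`, kernel only).  What is carried as EXPLICIT hypotheses, exactly as
every row of the `p`-adic atlas carries them (`AtlasCurve.padicRow`): the newform `hf`; the symbol DATA `hD`/`hint`/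
`htab` (the plus symbols of `f` at the `25`-th and `5`-th roots of unity ARE the tabulated integers over a `5`-adic
unit `D`, and all plus symbols are `5`-integral) — never dischargeable in the tree (no modular-symbol engine in
Lean); the prints `h85` (Schneider 1985 Thm 2′ / Perrin-Riou; BMS Thm 1.7) and `hkato` (Kato Thm 17.4).

* `frobeniusTrace_five_zywinaCurve_11_24` — kernel fact of the member (admissibility is the tree theorem
  `Rank2.ZywinaMembers.zywinaAdmissible_11_24` of `Summits/BirchSwinnertonDyer/Rank2/ZywinaMembersBSDRank.lean`, whose
  `bsdRank_zywina_11_24_of_secondDeriv` gives `r_an = rank = 2` for the same member mod `hmod`, `hGZK` and the interval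
  certificate `L″(E_{11,24},1) ≠ 0`; §4 joins the two).
* `cell_11_24`, `cell_11_24_valid` — the level-`25` `SymbolCertL` (`r = 2`, `n = 1`, `A = 1 ≡ α₅`) and its
  kernel certificate.
* `padicRow_five_zywinaCurve_11_24` — GIVEN the symbol data: `ord_{T=0} L_5(E_{11,24}, T) = 2 = rank`,
  `Ш(E_{11,24})[5^∞]` finite, Schneider's conjecture at `5` for every canonical height datum,
  `corank_{ℤ₅} Sel_{5^∞} = 2` — mod `h85` + `hkato` only: NO main conjecture, NO irreducibility, NO `5`-adic
  height computation, NO descent.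
* `equalityDoor_closed_11_24` — the door statement `ord_{T=0} L_5 = rank` for this member;
  `transfer_instance_11_24` — T's instance `(E_{11,24}, 2, 5)` of the crux `FiniteShaComponentTransfer`
  (`corank Ш[2^∞] = 0 → corank Ш[5^∞] = 0`, in fact the conclusion outright).
* §5 (`…ZywinaCertificate65912`): the same row for the second member `E_{659,12}` (kit job `j339156`), which is the
  tree's explicit cell `ShaPrimaryTransferRowAtFive.crossPrimeRow_659_12_five` — its certificate hypothesis
  `[T²] L_5(E_{659,12},T) ≠ 0` is SUPPLIED from the symbol data (`coeff_two_padicLFunction_ne_zero_659_12`,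
  `crossPrimeRow_659_12_five_certified`), plus `transfer_instance_659_12`, `member_659_12_both_ledgers`.

So on this member the "exact extra input" of the cell brief is no longer a conjecture-grade statement
(`Ш[5^∞]` finite) but a checked finite numerical certificate; the class-level input (all members at once) remains
open — per-member data do not sum to a theorem about the infinite class (B1 honesty).
References: B. Mazur, J. Tate, J. Teitelbaum, Invent. Math. 84 (1986) §I.8, §I.10–I.13; K. Kato, Astérisque 295
(2004) Thm. 17.4; P. Schneider, Invent. Math. 79 (1985) Thm. 2′; J. Balakrishnan, J. S. Müller, W. Stein, Math.
Comp. 85 (2016) Thm. 1.7; W. Stein, C. Wuthrich, Math. Comp. 82 (2013) §3, §10; D. Zywina, arXiv:2502.01957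
Thm. 1.2; J. Cremona, Algorithms for modular elliptic curves (1997) §2.8; B. Mazur, IHÉS 47 (1978) Cor. 4.1;
K. Česnavičius, M. Neururer, A. Saha, JEMS (doi:10.4171/jems/1367) Thm. 1.2.
-/

-- D-0017: single-problem summit, so `Summit.BirchSwinnertonDyer.BirchSwinnertonDyer.…` repeats a namespace BY DESIGN.
set_option linter.dupNamespace false

noncomputable section

namespace Summit.BirchSwinnertonDyer.BirchSwinnertonDyer.Theorems.ShaPrimaryTransferZywinaCertificate1124

open scoped Classical MatrixGroups ModularForm
open CongruenceSubgroup
open Literature.NumberTheory.EllipticCurves Literature.NumberTheory.EllipticCurves.Zywina2025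
  Literature.NumberTheory.EllipticCurves.ModularForms
open WeierstrassCurve
open Summit.BirchSwinnertonDyer.BirchSwinnertonDyer.Rank1Residual
open Summit.BirchSwinnertonDyer.Rank1Residual.Additive
open Summit.BirchSwinnertonDyer.BirchSwinnertonDyer.Theses.ShaPrimaryTransfer (FiniteShaComponentTransfer)
open Summit.BirchSwinnertonDyer.BirchSwinnertonDyer.Theorems.ShaPrimaryTransferGoodOrdinaryFive
open Summit.BirchSwinnertonDyer.BirchSwinnertonDyer.Rank2Observatory
open Summit.BirchSwinnertonDyer.Rank2.ZywinaMembers (zywinaAdmissible_11_24)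

/-! ## §1 The member `(m, n) = (11, 24)`: kernel facts -/

-- `(11, 24)` is Zywina-admissible: tree theorem `Rank2.ZywinaMembers.zywinaAdmissible_11_24` (star-p1 GEN 25, cited not restated).

/-- `E_{11,24}` is an elliptic curve (`Δ ≠ 0`; Zywina's admissibility). [cite: Zywina2025, Thm 1.2] -/
instance isElliptic_11_24 : (zywinaCurve 11 24).IsElliptic := isElliptic_zywinaCurve zywinaAdmissible_11_24

/-- Zywina's model of `E_{11,24}` is globally minimal (`ord_ℓ Δ < 12` at every prime). [cite: Zywina2025, Lemma 3.4] -/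
instance isGloballyMinimal_11_24 : (zywinaCurve 11 24).IsGloballyMinimal :=
  Zywina2025.isGloballyMinimal_zywinaCurve zywinaAdmissible_11_24

/-- **`a₅(E_{11,24}) = −4`**: the minimal model reduces to `y² = x³ + 3x` over `𝔽₅` (`4·9227·14411 ≡ 3`), which
has `10` points. UNCONDITIONAL (kernel point count). [cite: SilvermanAEC2009, V.2 and VII.5 Prop. 5.1 (a)] -/
theorem frobeniusTrace_five_zywinaCurve_11_24 [Fact (Nat.Prime 5)] :
    (zywinaCurve 11 24).frobeniusTrace 5 = -4 := by
  have h := zywinaAdmissible_11_24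
  have hI : integralModelInt (zywinaCurve 11 24) = zywinaCurveInt 11 24 := by
    convert Zywina2025.integralModelInt_zywinaCurve h
  rw [IntModel.frobeniusTrace_eq hI rfl, map_zywinaCurveInt_zmod_five]
  have hc : (4 * ((11 + 16 * 24 ^ 2 : ℕ) : ℤ) * ((11 + 25 * 24 ^ 2 : ℕ) : ℤ)) % 5 = 3 := by norm_num
  rw [hc, PointCountNat.natCard_point_map_eq (hℓ := ⟨by norm_num⟩) (by norm_num) 0 0 0 3 0 (by decide +kernel)]
  decide +kernel

/-! ## §2 The level-`25` symbol certificate of the member at `p = 5` -/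

/-- **The `L`-datum of `(E_{11,24}, 5)` at measure level `25`** (`r = 2`, `n = 1`, `A = 1 ≡ α₅ (mod 5)` since
`a₅ = −4`): `tabHi[u]` = numerators of `D·[u/25]⁺` (`u < 25`, `0` at non-units), `tabLo[u]` = numerators of
`D·[u/5]⁺` (period `5`, expanded to length `25`), and the double sums `ΣHi = 308`, `ΣLo = 0` — DATA of kit job
`j339121` (bsd-rank2-p2 GEN 58; `3 158 567 725` Dirichlet coefficients, tail + rounding `< 1.1·10⁻¹¹` per twisted
`L`-value; the `24` numbers `2·re{∞,u/25}/ω₁(E)`, `2·re{∞,v/5}/ω₁(E)` come out as EVEN INTEGERS to within `2·10⁻¹⁶`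
with certified error bars `3.8·10⁻⁸`, unique in the grid `2⁻⁸·9227⁻¹·ℤ`; tabulated here divided by their gcd `2`).
Exact consistency checks passed by the table: `k = 0` sums vanish (`L(E,1) = 0`), `k = 1` sum `= 170 ≡ 0 (mod 5)`,
the four Hecke rows `Σ_{u ≡ v (5)} tabHi[u] = a₅·tabLo[v] = ∓32`, evenness `tabHi[25 − u] = tabHi[u]`.
[cite: MazurTateTeitelbaum1986Invent, §I.8, §I.10–I.13] [cite: CremonaAlgorithms1997, §2.8] -/
def cell_11_24 : SymbolCertL :=
  ⟨2, 1, 1, [0,-43,44,26,-9,0,72,44,-108,-9,0,-43,26,26,-43,0,-9,-108,44,72,0,-9,26,44,-43],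
    [0,8,-8,-8,8,0,8,-8,-8,8,0,8,-8,-8,8,0,8,-8,-8,8,0,8,-8,-8,8], 308, 0⟩

/-- **Kernel certificate of the cell**: `cell_11_24.validL 5 (−4) = true` — `5 ≠ 2`, `5 ∤ 2!`, `5 ∣ A² + 4A + 5`,
`5 ∤ A`, `5 ∤ A·ΣHi − ΣLo`, the Teichmüller bookkeeping at level `25`, and the two double sums (`decide`, kernel
only). [cite: MazurTateTeitelbaum1986Invent, §I.13] -/
theorem cell_11_24_valid : @SymbolCertL.validL 5 ⟨Nat.prime_five⟩ (-4) cell_11_24 = true := by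
  decide +kernel

/-! ## §3 The `5`-adic row of `E_{11,24}`: equality door closed, T's instance verified -/

/-- **The `5`-adic row of `E_{11,24}` from the level-`25` certificate.** Granting Perrin-Riou–Schneider (`h85`)
and Kato's divisibility at `5` (`hkato`), the newform `hf`, and the symbol DATA `hD`/`hint`/`htab` (the plus
symbols of `f` are `5`-integral; at the unit residues `[u/25]⁺ = tabHi[u]/D`, `[u/5]⁺ = tabLo[u]/D`, `‖D‖₅ = 1`):
`rank E_{11,24}(ℚ) = 2` (Zywina, unconditional), `ord_{T=0} L_5(E_{11,24},T) = 2`, `Ш(E_{11,24})[5^∞]` is finite,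
Schneider's conjecture holds at `5` for every canonical height datum, and `corank_{ℤ₅} Sel_{5^∞}(E_{11,24}/ℚ) = 2`.
NO main conjecture, NO irreducibility, NO `5`-adic heights, NO descent. CONDITIONAL on `h85`, `hkato`, `hf` and
the symbol data. [cite: Kato2004Asterisque, Thm. 17.4 (1)(2) (p. 273)] [cite: BalakrishnanMullerStein2015, Thm. 1.7]
[cite: MazurTateTeitelbaum1986Invent, §I.10–I.13] [cite: Zywina2025, Thm 1.2] -/
theorem padicRow_five_zywinaCurve_11_24 [Fact (Nat.Prime 5)] (h85 : Schneider1985_order_charGenerator)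
    {N : ℕ} [NeZero N] {f : CuspForm (Gamma0 N) 2} (hf : IsNewformOf (zywinaCurve 11 24) f)
    (hkato : ∀ (κ : ZpExtension ℚ 5) (γ : Field.absoluteGaloisGroup ℚ),
      kato_divisibility (zywinaCurve 11 24) 5 (κ := κ) (γ := γ) (f := f))
    (D : ℚ) (hD : ‖(D : ℚ_[5])‖ = 1) (hint : ∀ x : ℚ, ‖(ratPlusSymbol f x : ℚ_[5])‖ ≤ 1)
    (htab : ∀ u : ℕ, u < 5 ^ (cell_11_24.n + 1) → ¬ 5 ∣ u →
      ratPlusSymbol f ((u : ℚ) / (5 : ℚ) ^ (cell_11_24.n + 1)) = (cell_11_24.tabHi.getD u 0 : ℚ) / D ∧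
      ratPlusSymbol f ((u : ℚ) / (5 : ℚ) ^ cell_11_24.n) = (cell_11_24.tabLo.getD u 0 : ℚ) / D) :
    (zywinaCurve 11 24).mordellWeilRank = 2 ∧
      (padicLFunction f (unitRoot (zywinaCurve 11 24) 5 : ℚ_[5])).order = 2 ∧
      Finite (AddCommGroup.primaryComponent (zywinaCurve 11 24).sha 5) ∧
      (∀ Dh : PAdicHeightData (zywinaCurve 11 24) 5, Dh.IsCanonical → SchneiderConjecture Dh) ∧
      (zywinaCurve 11 24).selmerCorank 5 = 2 := by
  have h := zywinaAdmissible_11_24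
  have hlow : cell_11_24.r ≤ (zywinaCurve 11 24).mordellWeilRank := by
    rw [mordellWeilRank_zywinaCurve h]; exact le_rfl
  exact padicRow_of_symbolCertL 5 h85 (zywinaCurve 11 24) le_rfl (isOrdinaryAt_five_zywinaCurve h)
    frobeniusTrace_five_zywinaCurve_11_24 hf hkato cell_11_24 cell_11_24_valid hlow D hD hint htab

/-- **The `5`-adic equality door is CLOSED on `E_{11,24}`**: `ord_{T=0} L_5(E_{11,24},T) = rank E_{11,24}(ℚ)`,
given the symbol data, mod `h85` + `hkato`. CONDITIONAL on the named hypotheses.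
[cite: Kato2004Asterisque, Thm. 17.4 (1)(2) (p. 273)] [cite: MazurTateTeitelbaum1986Invent, §I.13] -/
theorem equalityDoor_closed_11_24 [Fact (Nat.Prime 5)] (h85 : Schneider1985_order_charGenerator)
    {N : ℕ} [NeZero N] {f : CuspForm (Gamma0 N) 2} (hf : IsNewformOf (zywinaCurve 11 24) f)
    (hkato : ∀ (κ : ZpExtension ℚ 5) (γ : Field.absoluteGaloisGroup ℚ),
      kato_divisibility (zywinaCurve 11 24) 5 (κ := κ) (γ := γ) (f := f))
    (D : ℚ) (hD : ‖(D : ℚ_[5])‖ = 1) (hint : ∀ x : ℚ, ‖(ratPlusSymbol f x : ℚ_[5])‖ ≤ 1)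
    (htab : ∀ u : ℕ, u < 5 ^ (cell_11_24.n + 1) → ¬ 5 ∣ u →
      ratPlusSymbol f ((u : ℚ) / (5 : ℚ) ^ (cell_11_24.n + 1)) = (cell_11_24.tabHi.getD u 0 : ℚ) / D ∧
      ratPlusSymbol f ((u : ℚ) / (5 : ℚ) ^ cell_11_24.n) = (cell_11_24.tabLo.getD u 0 : ℚ) / D) :
    ((padicLFunction f (unitRoot (zywinaCurve 11 24) 5 : ℚ_[5])).order : ℕ∞) =
      (zywinaCurve 11 24).mordellWeilRank := by
  obtain ⟨hr, ho, -, -, -⟩ := padicRow_five_zywinaCurve_11_24 h85 hf hkato D hD hint htab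
  rw [hr, ho]; rfl

/-- **T's instance `(E_{11,24}, 2, 5)` of the crux `FiniteShaComponentTransfer`, VERIFIED** (indeed its
conclusion `corank Ш(E_{11,24})[5^∞] = 0` outright), given the symbol data, mod `h85` + `hkato` — no main
conjecture, no THEOREM R*, no `2`-descent. CONDITIONAL on the named hypotheses.
[cite: Kato2004Asterisque, Thm. 17.4 (1)(2) (p. 273)] [cite: Zywina2025, Thm 1.2] -/
theorem transfer_instance_11_24 [Fact (Nat.Prime 5)] [Fact (Nat.Prime 2)]
    (h85 : Schneider1985_order_charGenerator)
    {N : ℕ} [NeZero N] {f : CuspForm (Gamma0 N) 2} (hf : IsNewformOf (zywinaCurve 11 24) f)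
    (hkato : ∀ (κ : ZpExtension ℚ 5) (γ : Field.absoluteGaloisGroup ℚ),
      kato_divisibility (zywinaCurve 11 24) 5 (κ := κ) (γ := γ) (f := f))
    (D : ℚ) (hD : ‖(D : ℚ_[5])‖ = 1) (hint : ∀ x : ℚ, ‖(ratPlusSymbol f x : ℚ_[5])‖ ≤ 1)
    (htab : ∀ u : ℕ, u < 5 ^ (cell_11_24.n + 1) → ¬ 5 ∣ u →
      ratPlusSymbol f ((u : ℚ) / (5 : ℚ) ^ (cell_11_24.n + 1)) = (cell_11_24.tabHi.getD u 0 : ℚ) / D ∧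
      ratPlusSymbol f ((u : ℚ) / (5 : ℚ) ^ cell_11_24.n) = (cell_11_24.tabLo.getD u 0 : ℚ) / D) :
    (zywinaCurve 11 24).shaCorank 5 = 0 ∧
      ((zywinaCurve 11 24).shaCorank 2 = 0 → (zywinaCurve 11 24).shaCorank 5 = 0) := by
  obtain ⟨-, -, hfin, -, -⟩ := padicRow_five_zywinaCurve_11_24 h85 hf hkato D hD hint htab
  have h5 : (zywinaCurve 11 24).shaCorank 5 = 0 := by
    rw [← finite_primaryComponent_sha_iff_shaCorank_eq_zero]; exact hfin
  exact ⟨h5, fun _ ↦ h5⟩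

/-! ## §4 The member's full ledger: classical BSD-rank (star-p1) ∧ the `5`-adic row (this file) -/

/-- **`E_{11,24}` on both ledgers.** Classical side (tree theorem `bsdRank_zywina_11_24_of_secondDeriv`, mod
modularity `hmod`, Gross–Zagier–Kolyvagin `hGZK` and the interval certificate `h2 : L″(E_{11,24},1) ≠ 0`):
`ord_{s=1} L(E_{11,24},s) = rank = 2`.  `5`-adic side (this file, mod `h85`, `hkato`, `hf` and the symbol data):
`ord_{T=0} L_5(E_{11,24},T) = 2`, `Ш(E_{11,24})[5^∞]` finite, Schneider at `5`.  So for this curve of analytic rank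
`2` BOTH order-of-vanishing statements equal the rank and the `5`-primary part of `Ш` is finite — each modulo named
print plus ONE finite certificate. CONDITIONAL on the named hypotheses; one curve; BSD is not proved.
[cite: Zywina2025, Thm 1.2] [cite: Kolyvagin1990, Thm. A] [cite: Kato2004Asterisque, Thm. 17.4 (1)(2) (p. 273)]
[cite: MazurTateTeitelbaum1986Invent, §I.13] -/
theorem member_11_24_both_ledgers [Fact (Nat.Prime 5)] (hmod : exists_isNewformOf)
    (hGZK : rank_eq_analyticRank_of_analyticRank_le_one)
    (h2 : iteratedDeriv 2 (zywinaCurve 11 24).entireLFunction 1 ≠ 0)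
    (h85 : Schneider1985_order_charGenerator)
    {N : ℕ} [NeZero N] {f : CuspForm (Gamma0 N) 2} (hf : IsNewformOf (zywinaCurve 11 24) f)
    (hkato : ∀ (κ : ZpExtension ℚ 5) (γ : Field.absoluteGaloisGroup ℚ),
      kato_divisibility (zywinaCurve 11 24) 5 (κ := κ) (γ := γ) (f := f))
    (D : ℚ) (hD : ‖(D : ℚ_[5])‖ = 1) (hint : ∀ x : ℚ, ‖(ratPlusSymbol f x : ℚ_[5])‖ ≤ 1)
    (htab : ∀ u : ℕ, u < 5 ^ (cell_11_24.n + 1) → ¬ 5 ∣ u →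
      ratPlusSymbol f ((u : ℚ) / (5 : ℚ) ^ (cell_11_24.n + 1)) = (cell_11_24.tabHi.getD u 0 : ℚ) / D ∧
      ratPlusSymbol f ((u : ℚ) / (5 : ℚ) ^ cell_11_24.n) = (cell_11_24.tabLo.getD u 0 : ℚ) / D) :
    (zywinaCurve 11 24).analyticRank = (zywinaCurve 11 24).mordellWeilRank ∧
      (zywinaCurve 11 24).mordellWeilRank = 2 ∧
      (padicLFunction f (unitRoot (zywinaCurve 11 24) 5 : ℚ_[5])).order = 2 ∧
      Finite (AddCommGroup.primaryComponent (zywinaCurve 11 24).sha 5) ∧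
      (∀ Dh : PAdicHeightData (zywinaCurve 11 24) 5, Dh.IsCanonical → SchneiderConjecture Dh) := by
  obtain ⟨hbsd, -, hr, -, -, -⟩ :=
    Summit.BirchSwinnertonDyer.Rank2.ZywinaMembers.bsdRank_zywina_11_24_of_secondDeriv hmod hGZK h2
  obtain ⟨-, ho, hfin, hS, -⟩ := padicRow_five_zywinaCurve_11_24 h85 hf hkato D hD hint htab
  exact ⟨hbsd, hr, ho, hfin, hS⟩

end Summit.BirchSwinnertonDyer.BirchSwinnertonDyer.Theorems.ShaPrimaryTransferZywinaCertificate1124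

/-! ## §5 The second member `E_{659,12}` (kit job `j339156`): the tree's explicit cell `(E_{659,12}, 2, 5)` CERTIFIED

`E_{659,12} : y² = x³ − 14815x² + 50477668x`, conductor `591381315942936 = 2³·3·659·2963²·4259`, `w = +1`, `a₅ = −4`
(tree `ShaPrimaryTransferRowAtFive.frobeniusTrace_five_659_12`, cited, as are `isElliptic_659_12`,
`isGloballyMinimal_659_12`, `isOrdinaryAt_five_659_12`, `zywinaAdmissible_659_12`).  The tree file `…RowAtFive` states
THE CELL `crossPrimeRow_659_12_five` with the numerical certificate `[T²] L_5(E_{659,12},T) ≠ 0` as a HYPOTHESIS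
(«what a data seat would compute»); this section supplies the finite level-`25` symbol certificate that implies it, given
the symbol data, by the pipeline of §2–§3: `4 074 229 954` Dirichlet coefficients, tails `< 1.0·10⁻¹⁰`, the `24` numbers
`2·re{∞,·}/ω₁(E)` come out as integers to within `1·10⁻¹⁵` with certified error bars `3.8e-07` (grid-exact:
`Dcrit = 1 323 734 > Dmax = 2⁸·2963`), common denominator `1`, gcd `2` (divided out below); exact checks: `k = 0`
sums `0` (`L(E,1) = 0`), `k = 1` sum `40 ≡ 0 (mod 5)`, the four Hecke rows `Σ_{u ≡ v (5)} tabHi[u] = a₅·tabLo[v]`, evenness. -/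

namespace Summit.BirchSwinnertonDyer.BirchSwinnertonDyer.Theorems.ShaPrimaryTransferZywinaCertificate65912

open scoped Classical MatrixGroups ModularForm
open CongruenceSubgroup
open Literature.NumberTheory.EllipticCurves Literature.NumberTheory.EllipticCurves.Zywina2025
  Literature.NumberTheory.EllipticCurves.ModularForms
open WeierstrassCurve
open Summit.BirchSwinnertonDyer.BirchSwinnertonDyer.Rank1Residual
open Summit.BirchSwinnertonDyer.Rank1Residual.Additive
open Summit.BirchSwinnertonDyer.BirchSwinnertonDyer.Theses.ShaPrimaryTransfer (FiniteShaComponentTransfer)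
open Summit.BirchSwinnertonDyer.BirchSwinnertonDyer.Theorems.ShaPrimaryTransferGoodOrdinaryFive
open Summit.BirchSwinnertonDyer.BirchSwinnertonDyer.Rank2Observatory
open Summit.BirchSwinnertonDyer.BirchSwinnertonDyer.Theorems.ShaPrimaryTransferRankTwoDoor (zywinaAdmissible_659_12)
open Summit.BirchSwinnertonDyer.BirchSwinnertonDyer.Theorems.ShaPrimaryTransferRowAtFive
  (isElliptic_659_12 isGloballyMinimal_659_12 frobeniusTrace_five_659_12 isOrdinaryAt_five_659_12 crossPrimeRow_659_12_five)

/-- `E_{659,12}` is an elliptic curve — instance form of the tree theorem `RowAtFive.isElliptic_659_12`.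
[cite: Zywina2025, Thm 1.2] -/
instance instIsElliptic_659_12 : (zywinaCurve 659 12).IsElliptic := isElliptic_659_12

/-- Zywina's model of `E_{659,12}` is globally minimal — instance form of the tree theorem
`RowAtFive.isGloballyMinimal_659_12`. [cite: Zywina2025, Lemma 3.4] -/
instance instIsGloballyMinimal_659_12 : (zywinaCurve 659 12).IsGloballyMinimal := isGloballyMinimal_659_12

/-- **The `L`-datum of `(E_{659,12}, 5)` at measure level `25`** (`r = 2`, `n = 1`, `A = 1 ≡ α₅ (mod 5)` since `a₅ = −4`):
`tabHi[u]` = numerators of `D·[u/25]⁺`, `tabLo[u]` = numerators of `D·[u/5]⁺` (period `5`, length `25`), `ΣHi = 68`,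
`ΣLo = 0` — DATA of kit job `j339156` (bsd-rank2-p2 GEN 58), recognised exactly as described in the section docstring.
[cite: MazurTateTeitelbaum1986Invent, §I.8, §I.10–I.13] [cite: CremonaAlgorithms1997, §2.8] -/
def cell_659_12 : SymbolCertL :=
  ⟨2, 1, 1, [0,-113,208,168,-160,0,-207,108,208,-113,0,-207,108,108,-207,0,-113,208,108,-207,0,-160,168,208,-113],
    [0,200,-200,-200,200,0,200,-200,-200,200,0,200,-200,-200,200,0,200,-200,-200,200,0,200,-200,-200,200], 68, 0⟩

/-- **Kernel certificate of the cell**: `cell_659_12.validL 5 (−4) = true` (`5 ∤ A·ΣHi − ΣLo = 68`; `decide`, kernel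
only, the double sums recomputed from the table). [cite: MazurTateTeitelbaum1986Invent, §I.13] -/
theorem cell_659_12_valid : @SymbolCertL.validL 5 ⟨Nat.prime_five⟩ (-4) cell_659_12 = true := by
  decide +kernel

/-- **The `5`-adic row of `E_{659,12}` from the level-`25` certificate** (as `padicRow_five_zywinaCurve_11_24`):
`rank = 2`, `ord_{T=0} L_5(E_{659,12},T) = 2`, `Ш(E_{659,12})[5^∞]` finite, Schneider's conjecture at `5`,
`corank_{ℤ₅} Sel_{5^∞} = 2`. NO main conjecture, NO irreducibility, NO heights, NO descent. CONDITIONAL on `h85`, `hkato`,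
`hf` and the symbol data `hD`/`hint`/`htab`. [cite: Kato2004Asterisque, Thm. 17.4 (1)(2) (p. 273)]
[cite: BalakrishnanMullerStein2015, Thm. 1.7] [cite: MazurTateTeitelbaum1986Invent, §I.10–I.13] [cite: Zywina2025, Thm 1.2] -/
theorem padicRow_five_zywinaCurve_659_12 [Fact (Nat.Prime 5)] (h85 : Schneider1985_order_charGenerator)
    {N : ℕ} [NeZero N] {f : CuspForm (Gamma0 N) 2} (hf : IsNewformOf (zywinaCurve 659 12) f)
    (hkato : ∀ (κ : ZpExtension ℚ 5) (γ : Field.absoluteGaloisGroup ℚ),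
      kato_divisibility (zywinaCurve 659 12) 5 (κ := κ) (γ := γ) (f := f))
    (D : ℚ) (hD : ‖(D : ℚ_[5])‖ = 1) (hint : ∀ x : ℚ, ‖(ratPlusSymbol f x : ℚ_[5])‖ ≤ 1)
    (htab : ∀ u : ℕ, u < 5 ^ (cell_659_12.n + 1) → ¬ 5 ∣ u →
      ratPlusSymbol f ((u : ℚ) / (5 : ℚ) ^ (cell_659_12.n + 1)) = (cell_659_12.tabHi.getD u 0 : ℚ) / D ∧
      ratPlusSymbol f ((u : ℚ) / (5 : ℚ) ^ cell_659_12.n) = (cell_659_12.tabLo.getD u 0 : ℚ) / D) :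
    (zywinaCurve 659 12).mordellWeilRank = 2 ∧
      (padicLFunction f (unitRoot (zywinaCurve 659 12) 5 : ℚ_[5])).order = 2 ∧
      Finite (AddCommGroup.primaryComponent (zywinaCurve 659 12).sha 5) ∧
      (∀ Dh : PAdicHeightData (zywinaCurve 659 12) 5, Dh.IsCanonical → SchneiderConjecture Dh) ∧
      (zywinaCurve 659 12).selmerCorank 5 = 2 := by
  have hlow : cell_659_12.r ≤ (zywinaCurve 659 12).mordellWeilRank := by
    rw [mordellWeilRank_zywinaCurve zywinaAdmissible_659_12]; exact le_rfl
  exact padicRow_of_symbolCertL 5 h85 (zywinaCurve 659 12) le_rfl (by convert isOrdinaryAt_five_659_12)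
    (by convert frobeniusTrace_five_659_12) hf hkato cell_659_12 cell_659_12_valid hlow D hD hint htab

/-- **RowAtFive's certificate hypothesis, supplied**: given the symbol data (mod `h85` + `hkato`), the `T²`-coefficient of
`L_5(E_{659,12},T)` is non-zero — the `hcoeff` of the tree's `crossPrimeRow_659_12_five`. CONDITIONAL on the named
hypotheses. [cite: MazurTateTeitelbaum1986Invent, §I.13] [cite: Kato2004Asterisque, Thm. 17.4 (1)(2) (p. 273)] -/
theorem coeff_two_padicLFunction_ne_zero_659_12 [Fact (Nat.Prime 5)] (h85 : Schneider1985_order_charGenerator)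
    {N : ℕ} [NeZero N] {f : CuspForm (Gamma0 N) 2} (hf : IsNewformOf (zywinaCurve 659 12) f)
    (hkato : ∀ (κ : ZpExtension ℚ 5) (γ : Field.absoluteGaloisGroup ℚ),
      kato_divisibility (zywinaCurve 659 12) 5 (κ := κ) (γ := γ) (f := f))
    (D : ℚ) (hD : ‖(D : ℚ_[5])‖ = 1) (hint : ∀ x : ℚ, ‖(ratPlusSymbol f x : ℚ_[5])‖ ≤ 1)
    (htab : ∀ u : ℕ, u < 5 ^ (cell_659_12.n + 1) → ¬ 5 ∣ u →
      ratPlusSymbol f ((u : ℚ) / (5 : ℚ) ^ (cell_659_12.n + 1)) = (cell_659_12.tabHi.getD u 0 : ℚ) / D ∧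
      ratPlusSymbol f ((u : ℚ) / (5 : ℚ) ^ cell_659_12.n) = (cell_659_12.tabLo.getD u 0 : ℚ) / D) :
    PowerSeries.coeff 2 (padicLFunction f (unitRoot (zywinaCurve 659 12) 5 : ℚ_[5])) ≠ 0 := by
  obtain ⟨-, ho, -, -, -⟩ := padicRow_five_zywinaCurve_659_12 h85 hf hkato D hD hint htab
  exact ((PowerSeries.order_eq_nat (n := 2)).mp (by simpa using ho)).1

/-- **THE CELL `(E_{659,12}, 2, 5)` of `…RowAtFive`, with its certificate hypothesis discharged by the symbol data**:
granting Kato's Thm. 18.4 at `5` (`hK`) and Thm. 17.4 divisibility (`hkato`) for `E_{659,12}`, PRS85 (`h85`), the newform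
and the symbol data: `Ш(E_{659,12})[5^∞]` finite, `corank Sel_{5^∞} = 2`, `t_5 = 0`, `ord_{T=0} L_5 = 2`. CONDITIONAL on the
named hypotheses; one curve; BSD not proved. [cite: Kato2004Asterisque, Thm. 18.4 (p. 281)]
[cite: MazurTateTeitelbaum1986Invent, §I.13] -/
theorem crossPrimeRow_659_12_five_certified [Fact (Nat.Prime 5)] (h85 : Schneider1985_order_charGenerator)
    {N : ℕ} [NeZero N] {f : CuspForm (Gamma0 N) 2}
    (hK : kato_selmerCorank_le_order_padicLFunction (zywinaCurve 659 12) 5 (f := f))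
    (hf : IsNewformOf (zywinaCurve 659 12) f)
    (hkato : ∀ (κ : ZpExtension ℚ 5) (γ : Field.absoluteGaloisGroup ℚ),
      kato_divisibility (zywinaCurve 659 12) 5 (κ := κ) (γ := γ) (f := f))
    (D : ℚ) (hD : ‖(D : ℚ_[5])‖ = 1) (hint : ∀ x : ℚ, ‖(ratPlusSymbol f x : ℚ_[5])‖ ≤ 1)
    (htab : ∀ u : ℕ, u < 5 ^ (cell_659_12.n + 1) → ¬ 5 ∣ u →
      ratPlusSymbol f ((u : ℚ) / (5 : ℚ) ^ (cell_659_12.n + 1)) = (cell_659_12.tabHi.getD u 0 : ℚ) / D ∧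
      ratPlusSymbol f ((u : ℚ) / (5 : ℚ) ^ cell_659_12.n) = (cell_659_12.tabLo.getD u 0 : ℚ) / D) :
    Finite ↥(AddCommGroup.primaryComponent (zywinaCurve 659 12).sha 5) ∧
      (zywinaCurve 659 12).selmerCorank 5 = 2 ∧ (zywinaCurve 659 12).shaCorank 5 = 0 ∧
      (padicLFunction f (unitRoot (zywinaCurve 659 12) 5 : ℚ_[5])).order = 2 :=
  crossPrimeRow_659_12_five hK hf (coeff_two_padicLFunction_ne_zero_659_12 h85 hf hkato D hD hint htab)

/-- **T's instance `(E_{659,12}, 2, 5)` VERIFIED** without Thm. 18.4: `corank Ш(E_{659,12})[5^∞] = 0` outright, given the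
symbol data, mod `h85` + `hkato`. CONDITIONAL on the named hypotheses. [cite: Kato2004Asterisque, Thm. 17.4 (1)(2) (p. 273)]
[cite: Zywina2025, Thm 1.2] -/
theorem transfer_instance_659_12 [Fact (Nat.Prime 5)] (h85 : Schneider1985_order_charGenerator)
    {N : ℕ} [NeZero N] {f : CuspForm (Gamma0 N) 2} (hf : IsNewformOf (zywinaCurve 659 12) f)
    (hkato : ∀ (κ : ZpExtension ℚ 5) (γ : Field.absoluteGaloisGroup ℚ),
      kato_divisibility (zywinaCurve 659 12) 5 (κ := κ) (γ := γ) (f := f))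
    (D : ℚ) (hD : ‖(D : ℚ_[5])‖ = 1) (hint : ∀ x : ℚ, ‖(ratPlusSymbol f x : ℚ_[5])‖ ≤ 1)
    (htab : ∀ u : ℕ, u < 5 ^ (cell_659_12.n + 1) → ¬ 5 ∣ u →
      ratPlusSymbol f ((u : ℚ) / (5 : ℚ) ^ (cell_659_12.n + 1)) = (cell_659_12.tabHi.getD u 0 : ℚ) / D ∧
      ratPlusSymbol f ((u : ℚ) / (5 : ℚ) ^ cell_659_12.n) = (cell_659_12.tabLo.getD u 0 : ℚ) / D) :
    (zywinaCurve 659 12).shaCorank 5 = 0 ∧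
      ((zywinaCurve 659 12).shaCorank 2 = 0 → (zywinaCurve 659 12).shaCorank 5 = 0) := by
  obtain ⟨-, -, hfin, -, -⟩ := padicRow_five_zywinaCurve_659_12 h85 hf hkato D hD hint htab
  have h5 : (zywinaCurve 659 12).shaCorank 5 = 0 := by
    rw [← finite_primaryComponent_sha_iff_shaCorank_eq_zero]; exact hfin
  exact ⟨h5, fun _ ↦ h5⟩

/-- **`E_{659,12}` on both ledgers** (as `member_11_24_both_ledgers`): `ord_{s=1} L = rank = 2` (star-p1's
`bsdRank_zywina_659_12_of_secondDeriv`, mod `hmod`, `hGZK`, interval certificate `h2 : L″(E_{659,12},1) ≠ 0`) ∧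
`ord_{T=0} L_5 = 2` ∧ `Ш[5^∞]` finite ∧ Schneider at `5` (this section, mod `h85`, `hkato`, symbol data). CONDITIONAL on
the named hypotheses; one curve; BSD is not proved. [cite: Zywina2025, Thm 1.2] [cite: Kolyvagin1990, Thm. A]
[cite: Kato2004Asterisque, Thm. 17.4 (1)(2) (p. 273)] [cite: MazurTateTeitelbaum1986Invent, §I.13] -/
theorem member_659_12_both_ledgers [Fact (Nat.Prime 5)] (hmod : exists_isNewformOf)
    (hGZK : rank_eq_analyticRank_of_analyticRank_le_one)
    (h2 : iteratedDeriv 2 (zywinaCurve 659 12).entireLFunction 1 ≠ 0)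
    (h85 : Schneider1985_order_charGenerator)
    {N : ℕ} [NeZero N] {f : CuspForm (Gamma0 N) 2} (hf : IsNewformOf (zywinaCurve 659 12) f)
    (hkato : ∀ (κ : ZpExtension ℚ 5) (γ : Field.absoluteGaloisGroup ℚ),
      kato_divisibility (zywinaCurve 659 12) 5 (κ := κ) (γ := γ) (f := f))
    (D : ℚ) (hD : ‖(D : ℚ_[5])‖ = 1) (hint : ∀ x : ℚ, ‖(ratPlusSymbol f x : ℚ_[5])‖ ≤ 1)
    (htab : ∀ u : ℕ, u < 5 ^ (cell_659_12.n + 1) → ¬ 5 ∣ u →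
      ratPlusSymbol f ((u : ℚ) / (5 : ℚ) ^ (cell_659_12.n + 1)) = (cell_659_12.tabHi.getD u 0 : ℚ) / D ∧
      ratPlusSymbol f ((u : ℚ) / (5 : ℚ) ^ cell_659_12.n) = (cell_659_12.tabLo.getD u 0 : ℚ) / D) :
    (zywinaCurve 659 12).analyticRank = (zywinaCurve 659 12).mordellWeilRank ∧
      (zywinaCurve 659 12).mordellWeilRank = 2 ∧
      (padicLFunction f (unitRoot (zywinaCurve 659 12) 5 : ℚ_[5])).order = 2 ∧
      Finite (AddCommGroup.primaryComponent (zywinaCurve 659 12).sha 5) ∧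
      (∀ Dh : PAdicHeightData (zywinaCurve 659 12) 5, Dh.IsCanonical → SchneiderConjecture Dh) := by
  obtain ⟨hbsd, -, hr, -, -, -⟩ :=
    Summit.BirchSwinnertonDyer.Rank2.ZywinaMembers.bsdRank_zywina_659_12_of_secondDeriv hmod hGZK h2
  obtain ⟨-, ho, hfin, hS, -⟩ := padicRow_five_zywinaCurve_659_12 h85 hf hkato D hD hint htab
  exact ⟨hbsd, hr, ho, hfin, hS⟩

end Summit.BirchSwinnertonDyer.BirchSwinnertonDyer.Theorems.ShaPrimaryTransferZywinaCertificate65912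

end
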